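import Summits.ResolutionOfSingularities.ResolutionOfSingularities.Theses.PAlteration
import Summits.ResolutionOfSingularities.ResolutionOfSingularities.Theses.RadicialJung
import Summits.ResolutionOfSingularities.ResolutionOfSingularities.Theorems.PAlterationPialtKnownCases
import Summits.ResolutionOfSingularities.ResolutionOfSingularities.Theorems.PAlterationPalterationThesisPialtOfPerfect
import Summits.ResolutionOfSingularities.ResolutionOfSingularities.Theorems.Pialt.Negative.LoadBearing
import Summits.ResolutionOfSingularities.ResolutionOfSingularities.Theorems.Pialt.Negative.FiniteStrengtheningFalse
import Literature.AlgebraicGeometry.Resolution.KedlayaEtaleCovers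
import Literature.AlgebraicGeometry.Resolution.StrictNormalCrossings
import Literature.AlgebraicGeometry.Resolution.AlterationsPurelyInseparable
import Literature.AlgebraicGeometry.Resolution.AlterationsStrong
import Literature.AlgebraicGeometry.Resolution.AlterationsProofs
import Mathlib.AlgebraicGeometry.Morphisms.Smooth
import Mathlib.AlgebraicGeometry.Morphisms.Etale
import HarnessLib

/-!
# Skeleton `bundle-induction` — an ALTERNATIVE line for crux stmt-ResolutionOfSingularities-0555 `Pialt`
# (strategist s2, planner-cstrat-stmt-ResolutionOfSingularities-0555-s2-0, 2026-08-17; route RadicialJung /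
# shared with pAlteration, WildQuotients). Does NOT replace the lead's skeleton `Lines/SketchIdeator2.lean`.

`Pialt` = for every prime `p`, every integral separated `X` of finite type over a field of characteristic
`p` has a purely inseparable REGULAR alteration (Abramovich–Oort / Temkin 2013 Conj. 1.3.1). Card:
`Lines/bundle-induction.md`.

## The line: a DIMENSION INDUCTION for the pair version, through Kedlaya covers of `ℙⁿ⁺¹` and the
## `ℙ¹`-bundle of lines through a point (lenses: strengthen-to-induct + transfer of Jung's induction)

Strengthen the crux to PAIRS (de Jong's shape 4.1 with "alteration" ↦ "purely inseparable alteration"):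
`PiLogAltUpTo p n` — every integral separated finite-type `X` of dimension `≤ n` over a PERFECT field of
characteristic `p`, with a closed `Z ⊊ X`, has a purely inseparable alteration `g : X' → X`
(`Literature…IsPurelyInseparableAlteration`) with `X'` REGULAR and `g⁻¹ Z` inside a strict normal crossings
divisor. `Z = ∅` and the landed perfect-field transfer give `Pialt` (`Pialt_of`, kernel-checked below).

Induction on `n`. Given `(X, Z)` of dimension `n + 1` (WLOG normal projective: Chow + normalisation, as in
the landed `pialt_iff_forall_normal_isProjectiveOver`), KEDLAYA (J. Algebraic Geom. 14 (2005) Thm 1, PROVED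
in the tree in the form `Kedlaya2004_finite_etale_off_hyperplane_holds`; here with its clause (c) "`f(D) ⊆ H`")
gives a finite surjective `f : X → ℙⁿ⁺¹` ÉTALE over the chart `D₊(xₙ₊₁) ∋ v := (0:…:0:1)` with
`f(Z ∪ Sing X) ⊆ H := V₊(xₙ₊₁)`. Blow up the vertex `v` (de Jong 1996 proof of 4.11; in tree for `k = k̄`:
`DeJong1996VertexBlowupProjection_holds`): `b : B → ℙⁿ⁺¹`, with the projection from `v`,
`q : B → ℙⁿ`, a `ℙ¹`-BUNDLE (`ℙ(𝒪 ⊕ 𝒪(1))`, smooth proper of relative dimension 1) of which the strict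
transform of `H` is a SECTION `σ`; the cover pulls back to `f_B : X_B → B` (`X_B` = blow-up of `X` in the
finite étale `f⁻¹(v)`, normal, proper birational over `X`), finite, étale off `σ(ℙⁿ)`, with `Z_B` over
`σ(ℙⁿ)`. This is the NORMAL FORM `BundleCoverLogAlt p n`: a normal finite cover of a smooth proper relative
CURVE `q : B → H'` over a regular proper parameter space `H'` of dimension `≤ n`, étale off a section, the bad
set over the section. THE POINT (stub `stub_parameterChange`, known): this class is STABLE UNDER PURELY
INSEPARABLE REGULAR ALTERATION OF THE PARAMETER SPACE — for `α : H'' → H'` (e.g. produced by the induction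
hypothesis `PiLogAltUpTo p n` applied to `(H', Δ)` for ANY closed `Δ ⊊ H'`, or the regularised normalisation
of `H'` in ANY finite purely inseparable extension of `K(H')`), the pulled-back bundle `B ×_{H'} H''` is again
smooth over the regular `H''`, hence regular, and the normalised dominant component of the pulled-back cover
is again in the class and is a purely inseparable alteration of `X`. So inside the class the induction
hypothesis acts FOR FREE on the parameter space: every divisor of `H'` one meets (discriminant-refining data:
jump loci of conductors, non-log-smooth loci) may be assumed snc, and the residue field `K(H')` of the generic
point of the section may be perfected to any finite level — which makes the ramification of the cover along
`σ(H')` CLASSICAL (defectless, separable residue extensions; the NF lemma of card residue-perfecting-twist,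
STABLE under further p.i. extension of `K(H')`: e₁f₁ ≤ [E:F] = e₀f₀ ≤ e₁f₁). What is left is the open core
`stub_bundleCore`: the classical wild Abhyankar–Jung problem RELATIVE to a smooth curve fibration with all
parameter-space freedom granted (Abbes–Saito cleaning along `σ(H'') + q*Δ`, Artin–Schreier bricks, toric
endgame — the engine of route CleanCovers, here WITHOUT fierce ramification, and of card
residue-perfecting-twist, here WITHOUT its dimension-4 restriction "embedded resolution of the coefficient
divisors in dim n−1", which the induction hypothesis replaces).

Why it dodges the STUCK goals of the live line (`stub_relLURankOneNonAbhyankarPerfect` = local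
uniformization in char p; `stub_twoModelPatchingPerfect` = Piltant patching; jointly resolution over perfect
fields): no valuation, no local uniformization, no patching — the induction is Jung's (project, simplify the
branch data one dimension down, read the cover off), globally on projective varieties, and the
one-dimension-down step is the crux itself (pairs), not embedded resolution. Why it is not de Jong's curve
fibration (census (S6): "needs separable base alterations at three places"): no semistable reduction, no
moduli, no sections of the generic curve are used — only the FINITE map to the `ℙ¹`-bundle and ramification
along its section; purely inseparable alterations of the base change neither the étale site nor the
monodromy, and none is asked to.

## Stubs (6 registered; 5 sorries — `stub_piLogAlt_zero` is proved in rev 2) and composition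
* `stub_piLogAlt_zero`      — dimension 0 (PROVED here and as item evidence `PAlterationPialtBundleInductionZero.lean`).
* `stub_kedlayaPrescribed`  — Kedlaya 2005 Thm 1 WITH clause (c) `f(D) ⊆ H`, dimension pinned (KNOWN; the tree's
                              proof `Kedlaya2004.exists_finite_etale_off_hyperplane` has `S = {η}` and no `D`: extend
                              Lemma 4's form `t` to vanish on `D` as well — M/L).
* `stub_bundleOfCover`      — the vertex blow-up `ℙ(𝒪⊕𝒪(1)) → ℙᵐ` with its section over `V₊(x_{m+1})` and the
                              base-changed cover (KNOWN: de Jong 4.11 / Eisenbud–Harris 9.11; in tree over `k̄`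
                              as `DeJong1996VertexBlowupProjection_holds` + `IsBlowup` API — L).
* `stub_parameterChange`    — stability of the normal form under p.i. regular alteration of the parameter space
                              (KNOWN, pure scheme theory — L). Rev 2: REDUCED, kernel-checked, to ONE helper
                              `exists_cover_pullback` (registered) in `Lines/bundle_induction_parameterChange_plan.lean`
                              (bundle + section part proved: `exists_section_pullback`, `range_section_pullback`).
* `stub_bundleCore`         — THE OPEN CORE (crux-sized): induction hypothesis in dim `n` + parameter change ⇒
                              p.i. log-alteration of every bundle cover with parameter space of dim `≤ n`.
* `stub_pairsReduction`     — Kedlaya + bundle + core + IH ⇒ `PiLogAltUpTo p (n+1)` (KNOWN modulo its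
                              hypotheses: Chow / projective closure / normalisation for pairs, dimension split — L).
Composition: `piLogAltUpTo_all` by `Nat.rec`; `Pialt_of` = `Z := ∅` + `exists_topologicalKrullDim_le…` +
`pialtConclusion_of_exists_isPurelyInseparableAlteration` + `stub_pialtOfPerfect` — concludes
`Theses.PAlteration.Pialt` BY NAME (and `Theses.RadicialJung.Pialt`, definitionally equal).

Disproof used (`Cruxes/Pialt/Disproof.lean` v1.1; `Theorems/Pialt/Negative/*`, imported): every statement keeps
`IsIntegral` (`pialt_false_without_isIntegral/irreducible`) and finite type over a field
(`pialt_false_without_locallyOfFiniteType`); no stub asks finiteness over ALL of `X` (`not_pialtFinite`: the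
alterations here blow up — `X_B → X`, the toric endgame); radiciality is kept at every step (base changes along
p.i. alterations of the parameter space, blow-ups), so `pialt_without_universallyInjective_of_deJong1996` (= de
Jong, known) is not what is being proved; `pialt_birational_iff_resolutionOfSingularities`: no stub is the
birational strengthening (the parameter changes are genuinely radicial).
-/

set_option linter.dupNamespace false
set_option linter.unusedVariables false

noncomputable section

open CategoryTheory CategoryTheory.Limits AlgebraicGeometry TopologicalSpace
open Literature.AlgebraicGeometry.Resolution
open Summit.ResolutionOfSingularities.ResolutionOfSingularities.Theses.PAlteration (Pialt)

namespace Summit.ResolutionOfSingularities.ResolutionOfSingularities.Theorems.Pialt.BundleInduction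

/-! ## The statements of the induction (abbreviations; every stub signature below is fully inlined) -/

/-- `PiLogAltUpTo p n`: purely inseparable LOG-alteration of pairs `(X, Z)`, `dim X ≤ n`, over perfect fields of
characteristic `p` (de Jong 1996 Thm 4.1 / Temkin 2017 1.2.4 with "alteration" ↦ "purely inseparable alteration";
the strengthening of the crux that carries the induction). -/
def PiLogAltUpTo (p n : ℕ) : Prop :=
  ∀ (k : Type) [Field k] [CharP k p] [PerfectField k] (X : Scheme.{0}) (f : X ⟶ Spec (.of k)), IsSeparated f → LocallyOfFiniteType f → QuasiCompact f → IsIntegral X → topologicalKrullDim X ≤ ((n : ℕ) : WithBot ℕ∞) → ∀ Z : Set X, IsClosed Z → Z ≠ Set.univ → ∃ (X₃ : Scheme.{0}) (g : X₃ ⟶ X), IsPurelyInseparableAlteration g ∧ Scheme.IsRegular X₃ ∧ ∃ D : Set X₃, IsStrictNormalCrossingsDivisor X₃ D ∧ g.base ⁻¹' (Z) ⊆ D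

/-- `BundleCoverLogAlt p n`: the NORMAL FORM in dimension `n + 1` — purely inseparable log-alteration of every
normal finite cover `f : X → B` of a smooth proper relative curve `q : B → H'` with section `σ`, étale off
`σ(H')`, over a regular proper integral parameter space `H'` of dimension `≤ n`, the closed set `Z` lying over
the section. -/
def BundleCoverLogAlt (p n : ℕ) : Prop :=
  ∀ (k : Type) [Field k] [CharP k p] [PerfectField k] (H' : Scheme.{0}) (h' : H' ⟶ Spec (.of k)), IsProper h' → IsIntegral H' → Scheme.IsRegular H' → topologicalKrullDim H' ≤ ((n : ℕ) : WithBot ℕ∞) → ∀ (B : Scheme.{0}) (q : B ⟶ H') (σ : H' ⟶ B), IsProper q → SmoothOfRelativeDimension 1 q → σ ≫ q = 𝟙 H' → ∀ (X : Scheme.{0}) (f : X ⟶ B), IsIntegral X → (∀ x : X, IsIntegrallyClosed (X.presheaf.stalk x)) → IsFinite f → Function.Surjective f.base → (∀ U : B.Opens, Disjoint (U : Set B) (Set.range σ.base) → Etale (f ∣_ U)) → ∀ Z : Set X, IsClosed Z → f.base '' Z ⊆ Set.range σ.base → ∃ (X₃ : Scheme.{0}) (g : X₃ ⟶ X), IsPurelyInseparableAlteration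 g ∧ Scheme.IsRegular X₃ ∧ ∃ D : Set X₃, IsStrictNormalCrossingsDivisor X₃ D ∧ g.base ⁻¹' (Z) ⊆ D

/-- `ParameterChange p n`: the normal form is stable under purely inseparable REGULAR alteration `α : H'' → H'` of
the parameter space (pull the bundle back — smooth over regular, so regular; take the normalised dominant
component of the pulled-back cover; it is a purely inseparable alteration `π` of `X`, again étale off the
pulled-back section, with `π⁻¹ Z` over that section). KNOWN (scheme theory); the lever that lets the induction
hypothesis act on the parameter space. -/
def ParameterChange (p n : ℕ) : Prop :=
  ∀ (k : Type) [Field k] [CharP k p] [PerfectField k] (H' : Scheme.{0}) (h' : H' ⟶ Spec (.of k)), IsProper h' → IsIntegral H' → Scheme.IsRegular H' → topologicalKrullDim H' ≤ ((n : ℕ) : WithBot ℕ∞) → ∀ (B : Scheme.{0}) (q : B ⟶ H') (σ : H' ⟶ B), IsProper q → SmoothOfRelativeDimension 1 q → σ ≫ q = 𝟙 H' → ∀ (X : Scheme.{0}) (f : X ⟶ B), IsIntegral X → (∀ x : X, IsIntegrallyClosed (X.presheaf.stalk x)) → IsFinite f → Function.Surjective f.base → (∀ U : B.Opens, Disjoint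 (U : Set B) (Set.range σ.base) → Etale (f ∣_ U)) → ∀ Z : Set X, IsClosed Z → f.base '' Z ⊆ Set.range σ.base → ∀ (H'' : Scheme.{0}) (α : H'' ⟶ H'), IsPurelyInseparableAlteration α → Scheme.IsRegular H'' → ∃ (B'' : Scheme.{0}) (q'' : B'' ⟶ H'') (σ'' : H'' ⟶ B'') (X'' : Scheme.{0}) (f'' : X'' ⟶ B'') (π : X'' ⟶ X), IsProper q'' ∧ SmoothOfRelativeDimension 1 q'' ∧ σ'' ≫ q'' = 𝟙 H'' ∧ IsIntegral X'' ∧ (∀ x : X'', IsIntegrallyClosed (X''.presheaf.stalk x)) ∧ IsFinite f'' ∧ Function.Surjective f''.base ∧ (∀ U : B''.Opens, Disjoint (U : Set B'') (Set.range σ''.base) → Etale (f'' ∣_ U)) ∧ topologicalKrullDim H'' ≤ ((n : ℕ) : WithBot ℕ∞) ∧ IsPurelyInseparableAlteration π ∧ f'' ≫ q'' ≫ α = π ≫ f ≫ q ∧ f''.base '' (π.base ⁻¹' Z) ⊆ Set.range σ''.base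

/-! ## Stubs -/

/-- STUB (base of the induction) — PROVED below (rev 2); registered signature unchanged: dimension `≤ 0` — an integral scheme of finite type over a field
of dimension `0` is the spectrum of a field, hence regular; `g = 𝟙`, `D = ∅` (`Z ≠ univ` forces `Z = ∅`). -/
theorem stub_piLogAlt_zero (p : ℕ) (hp : p.Prime) :
    ∀ (k : Type) [Field k] [CharP k p] [PerfectField k] (X : Scheme.{0}) (f : X ⟶ Spec (.of k)), IsSeparated f → LocallyOfFiniteType f → QuasiCompact f → IsIntegral X → topologicalKrullDim X ≤ ((0 : ℕ) : WithBot ℕ∞) → ∀ Z : Set X, IsClosed Z → Z ≠ Set.univ → ∃ (X₃ : Scheme.{0}) (g : X₃ ⟶ X), IsPurelyInseparableAlteration g ∧ Scheme.IsRegular X₃ ∧ ∃ D : Set X₃, IsStrictNormalCrossingsDivisor X₃ D ∧ g.base ⁻¹' (Z) ⊆ D := by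
  -- PROVED (strategist s2; also item evidence PAlterationPialtBundleInductionZero.lean for landing by name):
  -- a 0-dimensional integral scheme is its generic point and is regular; `𝟙 X`, `D = ∅`.
  intro k _ _ _ X f hs hl hq hi hdim Z hZ hZu
  haveI := hi
  have hbir : IsBirational (𝟙 X) := ⟨⊤, by simp, by simp, inferInstance⟩
  refine ⟨X, 𝟙 X, hbir.isPurelyInseparableAlteration,
    Scheme.IsRegular.of_topologicalKrullDim_le_zero (by exact_mod_cast hdim), ∅,
    IsStrictNormalCrossingsDivisor.empty X, ?_⟩
  have hZe : Z = ∅ := by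
    by_contra hne
    obtain ⟨z, hz⟩ := Set.nonempty_iff_ne_empty.mpr hne
    apply hZu
    refine Set.eq_univ_of_forall fun x => ?_
    rw [eq_genericPoint_of_topologicalKrullDim_le_zero (by exact_mod_cast hdim) x,
      ← eq_genericPoint_of_topologicalKrullDim_le_zero (by exact_mod_cast hdim) z]
    exact hz
  subst hZe
  simp

/-- STUB (KNOWN — Kedlaya, *More étale covers of affine spaces in positive characteristic*, J. Algebraic Geom. 14
(2005) 187–192 = arXiv:math/0303382, **Theorem 1 with clause (c)** "`f(D) ⊆ H`", in the tree's specialised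
vocabulary of `Kedlaya2004_finite_etale_off_hyperplane` (PROVED there without `D`, `KedlayaEtaleCoversProofs`):
for `k` perfect of characteristic `p`, an integral `X` finite over some `ℙᴺ_k` with `dim X = m + 1` and a closed
`D ⊊ X`, there is a finite surjective `k`-morphism `f : X → ℙᵐ⁺¹_k`, étale over the chart `D₊(x_{m+1})`, with
`f(D)` inside the hyperplane `V₊(x_{m+1})`. (Printed: `D` any closed subscheme of dimension `< dim X`; the extra
work over the in-tree proof is Lemma 4 with `t` vanishing on `D ∪ (X ∖ U)`.) [cite: Kedlaya2004, Thm 1] -/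
theorem stub_kedlayaPrescribed (p : ℕ) (hp : p.Prime) :
    ∀ (k : Type) [Field k] [CharP k p] [PerfectField k] (m N : ℕ) (X : Scheme.{0}) (g : X ⟶ (Literature.AlgebraicGeometry.Motives.projectiveSpace N k).left), IsIntegral X → IsFinite g → topologicalKrullDim X = ((m + 1 : ℕ) : WithBot ℕ∞) → ∀ D : Set X, IsClosed D → D ≠ Set.univ → ∃ f : X ⟶ (Literature.AlgebraicGeometry.Motives.projectiveSpace (m + 1) k).left, f ≫ (Literature.AlgebraicGeometry.Motives.projectiveSpace (m + 1) k).hom = g ≫ (Literature.AlgebraicGeometry.Motives.projectiveSpace N k).hom ∧ IsFinite f ∧ Function.Surjective f.base ∧ (letI := MvPolynomial.gradedAlgebra (σ := Fin (m + 1 + 1)) (R := k); Etale (f ∣_ (Proj.basicOpen (MvPolynomial.homogeneousSubmodule (Fin (m + 1 + 1)) k) (MvPolynomial.X (Fin.last (m + 1))))) ∧ ∀ x ∈ D, x ∉ f ⁻¹ᵁ (Proj.basicOpen (MvPolynomial.homogeneousSubmodule (Fin (m + 1 + 1)) k) (MvPolynomial.X (Fin.last (m + 1))))) := by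
  sorry

/-- STUB (KNOWN — the blow-up of `ℙᵐ⁺¹` in the vertex `v = (0:…:0:1)` with the projection from `v`: a
`ℙ¹`-bundle `q : B = ℙ(𝒪 ⊕ 𝒪(1)) → ℙᵐ` (de Jong 1996, proof of 4.11; Eisenbud–Harris Prop. 9.11; in tree over
algebraically closed fields as `DeJong1996VertexBlowupProjection_holds` with `PointBlowupProjection` /
`IsVertexProjection`), of which the strict transform of the hyperplane `V₊(x_{m+1}) ∌ v` is a SECTION `σ`; and
the BASE-CHANGED COVER: for `f : X → ℙᵐ⁺¹` finite surjective with `X` normal integral, étale over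
`D₊(x_{m+1}) ∋ v`, `X_B := X ×_{ℙᵐ⁺¹} B` (= the blow-up of `X` in the finite étale `f⁻¹(v)`, NORMAL integral) is
finite over `B`, étale off `σ(ℙᵐ)`, proper birational (a purely inseparable alteration) over `X`, and points of
`X` over the hyperplane pull back over the section. [cite: DeJong1996, Lemma 4.11 (proof), p. 68] -/
theorem stub_bundleOfCover (p : ℕ) (hp : p.Prime) :
    ∀ (k : Type) [Field k] [CharP k p] [PerfectField k] (m : ℕ) (X : Scheme.{0}) (f : X ⟶ (Literature.AlgebraicGeometry.Motives.projectiveSpace (m + 1) k).left), IsIntegral X → (∀ x : X, IsIntegrallyClosed (X.presheaf.stalk x)) → IsFinite f → Function.Surjective f.base → (letI := MvPolynomial.gradedAlgebra (σ := Fin (m + 1 + 1)) (R := k); Etale (f ∣_ (Proj.basicOpen (MvPolynomial.homogeneousSubmodule (Fin (m + 1 + 1)) k) (MvPolynomial.X (Fin.last (m + 1)))))) → ∃ (B : Scheme.{0}) (b : B ⟶ (Literature.AlgebraicGeometry.Motives.projectiveSpace (m + 1) k).left) (q : B ⟶ (Literature.AlgebraicGeometry.Motives.projectiveSpace m k).left)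 (σ : (Literature.AlgebraicGeometry.Motives.projectiveSpace m k).left ⟶ B) (XB : Scheme.{0}) (fB : XB ⟶ B) (πX : XB ⟶ X), IsProper q ∧ SmoothOfRelativeDimension 1 q ∧ σ ≫ q = 𝟙 _ ∧ q ≫ (Literature.AlgebraicGeometry.Motives.projectiveSpace m k).hom = b ≫ (Literature.AlgebraicGeometry.Motives.projectiveSpace (m + 1) k).hom ∧ IsIntegral XB ∧ (∀ x : XB, IsIntegrallyClosed (XB.presheaf.stalk x)) ∧ IsFinite fB ∧ Function.Surjective fB.base ∧ (∀ U : B.Opens, Disjoint (U : Set B) (Set.range σ.base) → Etale (fB ∣_ U)) ∧ IsPurelyInseparableAlteration πX ∧ IsBirational πX ∧ fB ≫ b = πX ≫ f ∧ (letI := MvPolynomial.gradedAlgebra (σ := Fin (m + 1 + 1)) (R := k); ∀ x : X, x ∉ f ⁻¹ᵁ (Proj.basicOpen (MvPolynomial.homogeneousSubmodule (Fin (m + 1 + 1)) k) (MvPolynomial.X (Fin.last (m + 1)))) → fB.base '' (πX.base ⁻¹' {x}) ⊆ Set.range σ.base) := by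
  sorry

/-- STUB (KNOWN, scheme theory — the LEVER of the line, landable): `ParameterChange p n` — the normal form is
stable under purely inseparable regular alteration of the parameter space. Proof sketch: `B'' := B ×_{H'} H''`
(`q''` smooth proper of rel. dim. 1 by base change; `σ''` the pulled-back section, `range σ'' = ` preimage of
`range σ` because `σ(H') ≅ H'`); `K(X) ⊗_{K(B)} K(B'')` is a field (separable ⊗ purely inseparable), so the
pulled-back cover has ONE component dominating `B''`; `X''` := its normalisation; `f''` finite surjective, étale
(hence `X''` regular, = the fibre product) off `σ''`; `π : X'' → X` proper dominant, finite + universally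
injective over `f⁻¹(q⁻¹ U ∖ σ H')` where `α` is finite radicial over `U`; `dim H'' = dim H'`
(`IsPurelyInseparableAlteration.topologicalKrullDim_eq`). [folklore; EGA IV 17.7, Stacks 01S4/035E] -/
theorem stub_parameterChange (p : ℕ) (hp : p.Prime) (n : ℕ) :
    ∀ (k : Type) [Field k] [CharP k p] [PerfectField k] (H' : Scheme.{0}) (h' : H' ⟶ Spec (.of k)), IsProper h' → IsIntegral H' → Scheme.IsRegular H' → topologicalKrullDim H' ≤ ((n : ℕ) : WithBot ℕ∞) → ∀ (B : Scheme.{0}) (q : B ⟶ H') (σ : H' ⟶ B), IsProper q → SmoothOfRelativeDimension 1 q → σ ≫ q = 𝟙 H' → ∀ (X : Scheme.{0}) (f : X ⟶ B), IsIntegral X → (∀ x : X, IsIntegrallyClosed (X.presheaf.stalk x)) → IsFinite f → Function.Surjective f.base → (∀ U : B.Opens, Disjoint (U : Set B) (Set.range σ.base) → Etale (f ∣_ U)) → ∀ Z : Set X, IsClosed Z → f.base '' Z ⊆ Set.range σ.base → ∀ (H'' : Scheme.{0}) (α : H'' ⟶ H'), IsPurelyInseparableAlteration α → Scheme.IsRegular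 H'' → ∃ (B'' : Scheme.{0}) (q'' : B'' ⟶ H'') (σ'' : H'' ⟶ B'') (X'' : Scheme.{0}) (f'' : X'' ⟶ B'') (π : X'' ⟶ X), IsProper q'' ∧ SmoothOfRelativeDimension 1 q'' ∧ σ'' ≫ q'' = 𝟙 H'' ∧ IsIntegral X'' ∧ (∀ x : X'', IsIntegrallyClosed (X''.presheaf.stalk x)) ∧ IsFinite f'' ∧ Function.Surjective f''.base ∧ (∀ U : B''.Opens, Disjoint (U : Set B'') (Set.range σ''.base) → Etale (f'' ∣_ U)) ∧ topologicalKrullDim H'' ≤ ((n : ℕ) : WithBot ℕ∞) ∧ IsPurelyInseparableAlteration π ∧ f'' ≫ q'' ≫ α = π ≫ f ≫ q ∧ f''.base '' (π.base ⁻¹' Z) ⊆ Set.range σ''.base := by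
  sorry

/-- STUB (THE OPEN CORE — crux-sized; lens strengthen-to-induct + transfer of Jung/Kedlaya): given the induction
hypothesis `PiLogAltUpTo p n` (purely inseparable log-alteration of ALL pairs of dimension `≤ n`) and the
parameter-change lever, every bundle cover with parameter space of dimension `≤ n` admits a purely inseparable
log-alteration. Mechanism (card): (1) perfect `K(H')` to the level where the ramification of the cover along the
section is CLASSICAL and make the jump / non-clean loci `Δ ⊂ H'` snc — both by the IH through
`stub_parameterChange`, for free and stably; (2) Abbes–Saito / Kato cleaning of the (now residue-separable) wild
ramification along `σ(H'') + q''*Δ` by blow-ups of the bundle in centres inside the section (Kato 1994 Thm 4.1 is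
the case `n = 1`); (3) layer by layer along a central series of the `p`-Sylow of inertia, Artin–Schreier bricks
`w^p − x^{(p−1)Q} w − u x^R` with `p ∤ R` after the residue-perfecting normal form (card residue-perfecting-twist
(α)/(β)/E1–E4), Newton non-degenerate, resolved torically; tame part by Abhyankar's lemma. Open from `n = 3`
(covers of `ℙ¹`-bundles over threefolds = fourfolds); `n ≤ 2` known (CossartPiltant2019 + embedded resolution
of curves/points in threefolds). A counterexample is a fourfold cover with CLASSICAL wild ramification along a
section that no base-blow-up + toric step resolves even after every p.i. regular alteration of the parameter
threefold — it would refute log-resolution in characteristic `p`, not only this line.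
[cite: Kedlaya2004, Thm 1; AbbesSaito2011, §1.13, Prop. 15; Kato1994Ramification, Thm 4.1; Piltant2003, Thm 7.1] -/
theorem stub_bundleCore (p : ℕ) (hp : p.Prime) (n : ℕ) :
    (∀ (k : Type) [Field k] [CharP k p] [PerfectField k] (X : Scheme.{0}) (f : X ⟶ Spec (.of k)), IsSeparated f → LocallyOfFiniteType f → QuasiCompact f → IsIntegral X → topologicalKrullDim X ≤ ((n : ℕ) : WithBot ℕ∞) → ∀ Z : Set X, IsClosed Z → Z ≠ Set.univ → ∃ (X₃ : Scheme.{0}) (g : X₃ ⟶ X), IsPurelyInseparableAlteration g ∧ Scheme.IsRegular X₃ ∧ ∃ D : Set X₃, IsStrictNormalCrossingsDivisor X₃ D ∧ g.base ⁻¹' (Z) ⊆ D) →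
    (∀ (k : Type) [Field k] [CharP k p] [PerfectField k] (H' : Scheme.{0}) (h' : H' ⟶ Spec (.of k)), IsProper h' → IsIntegral H' → Scheme.IsRegular H' → topologicalKrullDim H' ≤ ((n : ℕ) : WithBot ℕ∞) → ∀ (B : Scheme.{0}) (q : B ⟶ H') (σ : H' ⟶ B), IsProper q → SmoothOfRelativeDimension 1 q → σ ≫ q = 𝟙 H' → ∀ (X : Scheme.{0}) (f : X ⟶ B), IsIntegral X → (∀ x : X, IsIntegrallyClosed (X.presheaf.stalk x)) → IsFinite f → Function.Surjective f.base → (∀ U : B.Opens, Disjoint (U : Set B) (Set.range σ.base) → Etale (f ∣_ U)) → ∀ Z : Set X, IsClosed Z → f.base '' Z ⊆ Set.range σ.base → ∀ (H'' : Scheme.{0}) (α : H'' ⟶ H'), IsPurelyInseparableAlteration α → Scheme.IsRegular H'' → ∃ (B'' : Scheme.{0}) (q'' : B'' ⟶ H'') (σ'' : H'' ⟶ B'') (X'' : Scheme.{0}) (f'' : X'' ⟶ B'') (π : X'' ⟶ X), IsProper q'' ∧ SmoothOfRelativeDimension 1 q'' ∧ σ'' ≫ q'' = 𝟙 H'' ∧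 IsIntegral X'' ∧ (∀ x : X'', IsIntegrallyClosed (X''.presheaf.stalk x)) ∧ IsFinite f'' ∧ Function.Surjective f''.base ∧ (∀ U : B''.Opens, Disjoint (U : Set B'') (Set.range σ''.base) → Etale (f'' ∣_ U)) ∧ topologicalKrullDim H'' ≤ ((n : ℕ) : WithBot ℕ∞) ∧ IsPurelyInseparableAlteration π ∧ f'' ≫ q'' ≫ α = π ≫ f ≫ q ∧ f''.base '' (π.base ⁻¹' Z) ⊆ Set.range σ''.base) →
    ∀ (k : Type) [Field k] [CharP k p] [PerfectField k] (H' : Scheme.{0}) (h' : H' ⟶ Spec (.of k)), IsProper h' → IsIntegral H' → Scheme.IsRegular H' → topologicalKrullDim H' ≤ ((n : ℕ) : WithBot ℕ∞) → ∀ (B : Scheme.{0}) (q : B ⟶ H') (σ : H' ⟶ B), IsProper q → SmoothOfRelativeDimension 1 q → σ ≫ q = 𝟙 H' → ∀ (X : Scheme.{0}) (f : X ⟶ B), IsIntegral X → (∀ x : X, IsIntegrallyClosed (X.presheaf.stalk x)) → IsFinite f → Function.Surjective f.base → (∀ U : B.Opens, Disjoint (U : Set B) (Set.range σ.base) → Etale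 (f ∣_ U)) → ∀ Z : Set X, IsClosed Z → f.base '' Z ⊆ Set.range σ.base → ∃ (X₃ : Scheme.{0}) (g : X₃ ⟶ X), IsPurelyInseparableAlteration g ∧ Scheme.IsRegular X₃ ∧ ∃ D : Set X₃, IsStrictNormalCrossingsDivisor X₃ D ∧ g.base ⁻¹' (Z) ⊆ D := by
  sorry

/-- STUB (KNOWN modulo its hypotheses — the Kedlaya–Jung REDUCTION for pairs, L-sized): dimension split
(`dim X ≤ n`: the IH; `dim X = n + 1`: below); Chow + projective closure + normalisation for pairs exactly as in
the landed `pialt_iff_forall_normal_isProjectiveOver` (restrict along the open immersion, descend along the proper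
birational maps, pull `Z` back and close it up); Kedlaya with `D := Z`; the vertex bundle and the base-changed
cover (`stub_bundleOfCover`); the core; compose the purely inseparable alterations
(`IsPurelyInseparableAlteration.comp`) and pull the snc divisor back along nothing (same `D`).
[cite: Kedlaya2004, Thm 1; DeJong1996, 4.11] -/
theorem stub_pairsReduction (p : ℕ) (hp : p.Prime) (n : ℕ) :
    (∀ (k : Type) [Field k] [CharP k p] [PerfectField k] (m N : ℕ) (X : Scheme.{0}) (g : X ⟶ (Literature.AlgebraicGeometry.Motives.projectiveSpace N k).left), IsIntegral X → IsFinite g → topologicalKrullDim X = ((m + 1 : ℕ) : WithBot ℕ∞) → ∀ D : Set X, IsClosed D → D ≠ Set.univ → ∃ f : X ⟶ (Literature.AlgebraicGeometry.Motives.projectiveSpace (m + 1) k).left, f ≫ (Literature.AlgebraicGeometry.Motives.projectiveSpace (m + 1) k).hom = g ≫ (Literature.AlgebraicGeometry.Motives.projectiveSpace N k).hom ∧ IsFinite f ∧ Function.Surjective f.base ∧ (letI := MvPolynomial.gradedAlgebra (σ := Fin (m + 1 + 1)) (R := k); Etale (f ∣_ (Proj.basicOpen (MvPolynomial.homogeneousSubmodule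 (Fin (m + 1 + 1)) k) (MvPolynomial.X (Fin.last (m + 1))))) ∧ ∀ x ∈ D, x ∉ f ⁻¹ᵁ (Proj.basicOpen (MvPolynomial.homogeneousSubmodule (Fin (m + 1 + 1)) k) (MvPolynomial.X (Fin.last (m + 1)))))) →
    (∀ (k : Type) [Field k] [CharP k p] [PerfectField k] (m : ℕ) (X : Scheme.{0}) (f : X ⟶ (Literature.AlgebraicGeometry.Motives.projectiveSpace (m + 1) k).left), IsIntegral X → (∀ x : X, IsIntegrallyClosed (X.presheaf.stalk x)) → IsFinite f → Function.Surjective f.base → (letI := MvPolynomial.gradedAlgebra (σ := Fin (m + 1 + 1)) (R := k); Etale (f ∣_ (Proj.basicOpen (MvPolynomial.homogeneousSubmodule (Fin (m + 1 + 1)) k) (MvPolynomial.X (Fin.last (m + 1)))))) → ∃ (B : Scheme.{0}) (b : B ⟶ (Literature.AlgebraicGeometry.Motives.projectiveSpace (m + 1) k).left) (q : B ⟶ (Literature.AlgebraicGeometry.Motives.projectiveSpace m k).left) (σ : (Literature.AlgebraicGeometry.Motives.projectiveSpace m k).left ⟶ B) (XB : Scheme.{0}) (fB : XB ⟶ B)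 (πX : XB ⟶ X), IsProper q ∧ SmoothOfRelativeDimension 1 q ∧ σ ≫ q = 𝟙 _ ∧ q ≫ (Literature.AlgebraicGeometry.Motives.projectiveSpace m k).hom = b ≫ (Literature.AlgebraicGeometry.Motives.projectiveSpace (m + 1) k).hom ∧ IsIntegral XB ∧ (∀ x : XB, IsIntegrallyClosed (XB.presheaf.stalk x)) ∧ IsFinite fB ∧ Function.Surjective fB.base ∧ (∀ U : B.Opens, Disjoint (U : Set B) (Set.range σ.base) → Etale (fB ∣_ U)) ∧ IsPurelyInseparableAlteration πX ∧ IsBirational πX ∧ fB ≫ b = πX ≫ f ∧ (letI := MvPolynomial.gradedAlgebra (σ := Fin (m + 1 + 1)) (R := k); ∀ x : X, x ∉ f ⁻¹ᵁ (Proj.basicOpen (MvPolynomial.homogeneousSubmodule (Fin (m + 1 + 1)) k) (MvPolynomial.X (Fin.last (m + 1)))) → fB.base '' (πX.base ⁻¹' {x}) ⊆ Set.range σ.base)) →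
    (∀ (k : Type) [Field k] [CharP k p] [PerfectField k] (H' : Scheme.{0}) (h' : H' ⟶ Spec (.of k)), IsProper h' → IsIntegral H' → Scheme.IsRegular H' → topologicalKrullDim H' ≤ ((n : ℕ) : WithBot ℕ∞) → ∀ (B : Scheme.{0}) (q : B ⟶ H') (σ : H' ⟶ B), IsProper q → SmoothOfRelativeDimension 1 q → σ ≫ q = 𝟙 H' → ∀ (X : Scheme.{0}) (f : X ⟶ B), IsIntegral X → (∀ x : X, IsIntegrallyClosed (X.presheaf.stalk x)) → IsFinite f → Function.Surjective f.base → (∀ U : B.Opens, Disjoint (U : Set B) (Set.range σ.base) → Etale (f ∣_ U)) → ∀ Z : Set X, IsClosed Z → f.base '' Z ⊆ Set.range σ.base → ∃ (X₃ : Scheme.{0}) (g : X₃ ⟶ X), IsPurelyInseparableAlteration g ∧ Scheme.IsRegular X₃ ∧ ∃ D : Set X₃, IsStrictNormalCrossingsDivisor X₃ D ∧ g.base ⁻¹' (Z) ⊆ D) →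
    (∀ (k : Type) [Field k] [CharP k p] [PerfectField k] (X : Scheme.{0}) (f : X ⟶ Spec (.of k)), IsSeparated f → LocallyOfFiniteType f → QuasiCompact f → IsIntegral X → topologicalKrullDim X ≤ ((n : ℕ) : WithBot ℕ∞) → ∀ Z : Set X, IsClosed Z → Z ≠ Set.univ → ∃ (X₃ : Scheme.{0}) (g : X₃ ⟶ X), IsPurelyInseparableAlteration g ∧ Scheme.IsRegular X₃ ∧ ∃ D : Set X₃, IsStrictNormalCrossingsDivisor X₃ D ∧ g.base ⁻¹' (Z) ⊆ D) →
    ∀ (k : Type) [Field k] [CharP k p] [PerfectField k] (X : Scheme.{0}) (f : X ⟶ Spec (.of k)), IsSeparated f → LocallyOfFiniteType f → QuasiCompact f → IsIntegral X → topologicalKrullDim X ≤ ((n + 1 : ℕ) : WithBot ℕ∞) → ∀ Z : Set X, IsClosed Z → Z ≠ Set.univ → ∃ (X₃ : Scheme.{0}) (g : X₃ ⟶ X), IsPurelyInseparableAlteration g ∧ Scheme.IsRegular X₃ ∧ ∃ D : Set X₃, IsStrictNormalCrossingsDivisor X₃ D ∧ g.base ⁻¹' (Z) ⊆ D := by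
  sorry

/-! ## Composition (no `sorry` below this line) -/

/-- The stubs are literally the abbreviations (sanity, `Iff.rfl`). -/
example (p n : ℕ) : PiLogAltUpTo p n ↔ (∀ (k : Type) [Field k] [CharP k p] [PerfectField k] (X : Scheme.{0}) (f : X ⟶ Spec (.of k)), IsSeparated f → LocallyOfFiniteType f → QuasiCompact f → IsIntegral X → topologicalKrullDim X ≤ ((n : ℕ) : WithBot ℕ∞) → ∀ Z : Set X, IsClosed Z → Z ≠ Set.univ → ∃ (X₃ : Scheme.{0}) (g : X₃ ⟶ X), IsPurelyInseparableAlteration g ∧ Scheme.IsRegular X₃ ∧ ∃ D : Set X₃, IsStrictNormalCrossingsDivisor X₃ D ∧ g.base ⁻¹' (Z) ⊆ D) := Iff.rfl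
example (p n : ℕ) : BundleCoverLogAlt p n ↔ (∀ (k : Type) [Field k] [CharP k p] [PerfectField k] (H' : Scheme.{0}) (h' : H' ⟶ Spec (.of k)), IsProper h' → IsIntegral H' → Scheme.IsRegular H' → topologicalKrullDim H' ≤ ((n : ℕ) : WithBot ℕ∞) → ∀ (B : Scheme.{0}) (q : B ⟶ H') (σ : H' ⟶ B), IsProper q → SmoothOfRelativeDimension 1 q → σ ≫ q = 𝟙 H' → ∀ (X : Scheme.{0}) (f : X ⟶ B), IsIntegral X → (∀ x : X, IsIntegrallyClosed (X.presheaf.stalk x)) → IsFinite f → Function.Surjective f.base → (∀ U : B.Opens, Disjoint (U : Set B) (Set.range σ.base) → Etale (f ∣_ U)) → ∀ Z : Set X, IsClosed Z → f.base '' Z ⊆ Set.range σ.base → ∃ (X₃ : Scheme.{0}) (g : X₃ ⟶ X), IsPurelyInseparableAlteration g ∧ Scheme.IsRegular X₃ ∧ ∃ D : Set X₃, IsStrictNormalCrossingsDivisor X₃ D ∧ g.base ⁻¹' (Z) ⊆ D) := Iff.rfl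
example (p n : ℕ) : ParameterChange p n ↔ (∀ (k : Type) [Field k] [CharP k p] [PerfectField k] (H' : Scheme.{0}) (h' : H' ⟶ Spec (.of k)), IsProper h' → IsIntegral H' → Scheme.IsRegular H' → topologicalKrullDim H' ≤ ((n : ℕ) : WithBot ℕ∞) → ∀ (B : Scheme.{0}) (q : B ⟶ H') (σ : H' ⟶ B), IsProper q → SmoothOfRelativeDimension 1 q → σ ≫ q = 𝟙 H' → ∀ (X : Scheme.{0}) (f : X ⟶ B), IsIntegral X → (∀ x : X, IsIntegrallyClosed (X.presheaf.stalk x)) → IsFinite f → Function.Surjective f.base → (∀ U : B.Opens, Disjoint (U : Set B) (Set.range σ.base) → Etale (f ∣_ U)) → ∀ Z : Set X, IsClosed Z → f.base '' Z ⊆ Set.range σ.base → ∀ (H'' : Scheme.{0}) (α : H'' ⟶ H'), IsPurelyInseparableAlteration α → Scheme.IsRegular H'' → ∃ (B'' : Scheme.{0}) (q'' : B'' ⟶ H'') (σ'' : H'' ⟶ B'') (X'' : Scheme.{0}) (f'' : X'' ⟶ B'') (π : X'' ⟶ X), IsProper q'' ∧ SmoothOfRelativeDimension 1 q'' ∧ σ''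 ≫ q'' = 𝟙 H'' ∧ IsIntegral X'' ∧ (∀ x : X'', IsIntegrallyClosed (X''.presheaf.stalk x)) ∧ IsFinite f'' ∧ Function.Surjective f''.base ∧ (∀ U : B''.Opens, Disjoint (U : Set B'') (Set.range σ''.base) → Etale (f'' ∣_ U)) ∧ topologicalKrullDim H'' ≤ ((n : ℕ) : WithBot ℕ∞) ∧ IsPurelyInseparableAlteration π ∧ f'' ≫ q'' ≫ α = π ≫ f ≫ q ∧ f''.base '' (π.base ⁻¹' Z) ⊆ Set.range σ''.base) := Iff.rfl

/-- **The induction**: purely inseparable log-alteration of pairs in every dimension over perfect fields of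
characteristic `p`, from the six stubs. -/
theorem piLogAltUpTo_all (p : ℕ) (hp : p.Prime) : ∀ n : ℕ, PiLogAltUpTo p n := by
  intro n
  induction n with
  | zero => exact stub_piLogAlt_zero p hp
  | succ n ih =>
    exact stub_pairsReduction p hp n (stub_kedlayaPrescribed p hp) (stub_bundleOfCover p hp)
      (stub_bundleCore p hp n ih (stub_parameterChange p hp n)) ih

/-- The crux conclusion at one integral separated finite-type `X` over a PERFECT field, from the induction
(`Z := ∅`; `dim X < ∞` by `exists_topologicalKrullDim_le_of_locallyOfFiniteType`). -/
theorem pialtShape_perfectField (p : ℕ) (hp : p.Prime) (k : Type) [Field k] [CharP k p] [PerfectField k]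
    (X : Scheme.{0}) (f : X ⟶ Spec (.of k)) [IsSeparated f] [LocallyOfFiniteType f] [QuasiCompact f]
    [IsIntegral X] :
    ∃ (X' : Scheme.{0}) (g : X' ⟶ X), IsProper g ∧ IsIntegral X' ∧ Scheme.IsRegular X' ∧
      Function.Surjective g.base ∧ ∃ U : X.Opens, Dense (U : Set X) ∧ IsFinite (g ∣_ U) ∧
        UniversallyInjective (g ∣_ U) := by
  haveI : CompactSpace X := QuasiCompact.compactSpace_of_compactSpace f
  obtain ⟨d, hd⟩ := exists_topologicalKrullDim_le_of_locallyOfFiniteType f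
  have hne : (∅ : Set X) ≠ Set.univ := by
    intro h
    have : (genericPoint X) ∈ (∅ : Set X) := by rw [h]; trivial
    exact this
  obtain ⟨X₃, g, hg, hreg, -⟩ :=
    piLogAltUpTo_all p hp d k X f inferInstance inferInstance inferInstance inferInstance hd ∅
      isClosed_empty hne
  exact pialtConclusion_of_exists_isPurelyInseparableAlteration ⟨X₃, g, hg, hreg⟩

/-- COMPOSITION: the crux `Pialt` BY NAME from the stubs (perfect fields suffice:
`PalterationThesis.PerfectTransfer.stub_pialtOfPerfect` = `pialt_of_pialt_perfectField`). -/
theorem Pialt_of : Pialt := by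
  intro p hp k _ _ X f hs hl hq hi
  haveI : Fact p.Prime := ⟨hp⟩
  haveI := hs; haveI := hl; haveI := hq; haveI := hi
  exact PalterationThesis.PerfectTransfer.stub_pialtOfPerfect p k
    (fun Y g hs' hl' hq' hi' => by
      haveI := hs'; haveI := hl'; haveI := hq'; haveI := hi'
      exact pialtShape_perfectField p hp (PerfectClosure k p) Y g) X f

/-- The same for the bet route's decl (definitionally equal). -/
theorem RadicialJung_Pialt_of :
    Summit.ResolutionOfSingularities.ResolutionOfSingularities.Theses.RadicialJung.Pialt := Pialt_of

end Summit.ResolutionOfSingularities.ResolutionOfSingularities.Theorems.Pialt.BundleInduction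

end
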